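import Mathlib
import Summits.Ventures.PercRepro2.Defs
import Summits.Ventures.PercRepro2.Independence
import Summits.Ventures.PercRepro2.Harris
import Summits.Ventures.PercRepro2.Graph
import Summits.Ventures.PercRepro2.Events
import Summits.Ventures.PercRepro2.Induced
import Summits.Ventures.PercRepro2.Frontier
import Summits.Ventures.PercRepro2.ObsIndependence
import Summits.Ventures.PercRepro2.BTVFamilyDefs
import Summits.Ventures.PercRepro2.BTVFamilyReveal

/-!
# The merged V-family behind (B-T): tower identities and the pinned weights
(blind cell PercRepro2, mine-1 g52; paper proofs/MINE1-BT.md §2.4 (F3), §2.5)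

Two probabilistic tools.  (1) `prob_reveal`: the tower identity at a vertex `z` — when an event
`X` is, pointwise, the event `Φ (frontier ω)` of `G[U ∖ z]`, then
`P(X) = ∑_ω weight p ω · P(Φ (frontier ω))` (the cell's `expect_tower` with the edges at `z`
against the edges inside `U ∖ z`); its eight instances for the four cells.  (2) `pinU`: the edge
weights of `G[U]` (`p` inside `U`, `0` outside) and the transfer identity
`P_p(induced ω ∈ A) = P_{pinU}(A)`, which lets whole-graph theorems be applied on `G[U]`.
-/

namespace Summit.Ventures.PercRepro2

namespace BTVFamily

/-! ## The tower identities: revealing the edges at `z` -/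

section Tower

variable {V : Type*} {E : Type*} [Fintype E] [DecidableEq E] [Fintype V] [DecidableEq V]
  {R : Type*} [CommRing R]

omit [Fintype E] [DecidableEq E] [Fintype V] [DecidableEq V] in
/-- An event defined through the configuration induced on `U` is determined by the edges inside
`U`. -/
lemma dependsOn_induced_event (ends : E → Sym2 V) (U : Finset V) (P : Config E → Prop) :
    DependsOn (· ∈ {ω : Config E | P (induced ends (↑U) ω)}) (within ends (↑U)) := by
  intro ω ω' h
  show P (induced ends (↑U) ω) = P (induced ends (↑U) ω')
  rw [induced_congr h]

/-- **Tower identity at a vertex**: if `X` is, pointwise, the event `Φ (frontier ω)` on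
`G[U ∖ z]`, then `P(X) = ∑_ω weight p ω · P(Φ (frontier ω))`. -/
theorem prob_reveal (p : E → R) (ends : E → Sym2 V) (U : Finset V) (z : V)
    {X : Set (Config E)} {Φ : Finset V → Set (Config E)}
    (hΦ : ∀ T, DependsOn (· ∈ Φ T) (within ends (↑(U \ {z}))))
    (hX : ∀ ω, ω ∈ X ↔ ω ∈ Φ (frontier ends U {z} ω)) :
    prob p X = ∑ ω, weight p ω * prob p (Φ (frontier ends U {z} ω)) := by
  have e : X.indicator (1 : Config E → R) =
      fun ω => (Φ (frontier ends U {z} ω)).indicator 1 ω := by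
    funext ω
    by_cases h : ω ∈ X
    · rw [Set.indicator_of_mem h, Set.indicator_of_mem ((hX ω).1 h)]
    · rw [Set.indicator_of_notMem h, Set.indicator_of_notMem fun h' => h ((hX ω).2 h')]
  rw [prob_eq_expect_indicator, e]
  rw [expect_tower p (F₁ := fun _ => touches ends (↑({z} : Finset V)))
    (F₂ := fun _ => within ends (↑(U \ {z}))) (S := frontier ends U {z})
    (Φ := fun T => (Φ T).indicator 1)
    (fun _ => disjoint_touches_within_sdiff ends U {z})
    (fun T ω ω' h => by
      show (frontier ends U {z} ω = T) = (frontier ends U {z} ω' = T)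
      rw [dependsOn_frontier ends U {z} h])
    fun T => dependsOn_indicator (hΦ T)]
  simp_rw [prob_eq_expect_indicator]

variable (p : E → R) (ends : E → Sym2 V) {U : Finset V} {z : V} (hzU : z ∈ U) {s t v : V}
  (hzs : z ≠ s) (hzt : z ≠ t) (hzv : z ≠ v)
include hzU hzs hzt hzv

omit hzv in
/-- Tower identity for `a`, `z` a `u`-vertex. -/
lemma prob_aEv_reveal_A {A W : Finset V} (hzA : z ∈ A) (hzW : z ∉ W) :
    prob p (aEv ends U s t v A W) = ∑ ω, weight p ω *
      prob p (aEv ends (U \ {z}) s t v (A.erase z ∪ frontier ends U {z} ω) W) :=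
  prob_reveal p ends U z (Φ := fun T => aEv ends (U \ {z}) s t v (A.erase z ∪ T) W)
    (fun T => dependsOn_induced_event ends (U \ {z}) (aProp ends s t v (A.erase z ∪ T) W))
    (fun _ => aEv_reveal_A hzU hzs hzt hzA hzW)

omit hzv in
/-- Tower identity for `a`, `z` a `w`-vertex. -/
lemma prob_aEv_reveal_W {A W : Finset V} (hzA : z ∉ A) (hzW : z ∈ W) :
    prob p (aEv ends U s t v A W) = ∑ ω, weight p ω *
      prob p (aEv ends (U \ {z}) s t v A (W.erase z ∪ frontier ends U {z} ω)) :=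
  prob_reveal p ends U z (Φ := fun T => aEv ends (U \ {z}) s t v A (W.erase z ∪ T))
    (fun T => dependsOn_induced_event ends (U \ {z}) (aProp ends s t v A (W.erase z ∪ T)))
    (fun _ => aEv_reveal_W hzU hzs hzt hzA hzW)

omit hzv in
/-- Tower identity for `b`, `z` a `u`-vertex. -/
lemma prob_bEv_reveal_A {A W : Finset V} (hzA : z ∈ A) (hzW : z ∉ W) :
    prob p (bEv ends U s t v A W) = ∑ ω, weight p ω *
      prob p (bEv ends (U \ {z}) s t v (A.erase z ∪ frontier ends U {z} ω) W) :=
  prob_reveal p ends U z (Φ := fun T => bEv ends (U \ {z}) s t v (A.erase z ∪ T) W)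
    (fun T => dependsOn_induced_event ends (U \ {z}) (bProp ends s t v (A.erase z ∪ T) W))
    (fun _ => bEv_reveal_A hzU hzs hzt hzA hzW)

omit hzv in
/-- Tower identity for `b`, `z` a `w`-vertex. -/
lemma prob_bEv_reveal_W {A W : Finset V} (hzA : z ∉ A) (hzW : z ∈ W) :
    prob p (bEv ends U s t v A W) = ∑ ω, weight p ω *
      prob p (bEv ends (U \ {z}) s t v A (W.erase z ∪ frontier ends U {z} ω)) :=
  prob_reveal p ends U z (Φ := fun T => bEv ends (U \ {z}) s t v A (W.erase z ∪ T))
    (fun T => dependsOn_induced_event ends (U \ {z}) (bProp ends s t v A (W.erase z ∪ T)))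
    (fun _ => bEv_reveal_W hzU hzs hzt hzA hzW)

/-- Tower identity for `j`, `z` a `u`-vertex. -/
lemma prob_jEv_reveal_A {A W : Finset V} (hzA : z ∈ A) (hzW : z ∉ W) :
    prob p (jEv ends U s t v A W) = ∑ ω, weight p ω *
      prob p (jEv ends (U \ {z}) s t v (A.erase z ∪ frontier ends U {z} ω) W) :=
  prob_reveal p ends U z (Φ := fun T => jEv ends (U \ {z}) s t v (A.erase z ∪ T) W)
    (fun T => dependsOn_induced_event ends (U \ {z}) (jProp ends s t v (A.erase z ∪ T) W))
    (fun _ => jEv_reveal_A hzU hzs hzt hzv hzA hzW)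

/-- Tower identity for `j`, `z` a `w`-vertex. -/
lemma prob_jEv_reveal_W {A W : Finset V} (hzA : z ∉ A) (hzW : z ∈ W) :
    prob p (jEv ends U s t v A W) = ∑ ω, weight p ω *
      prob p (jEv ends (U \ {z}) s t v A (W.erase z ∪ frontier ends U {z} ω)) :=
  prob_reveal p ends U z (Φ := fun T => jEv ends (U \ {z}) s t v A (W.erase z ∪ T))
    (fun T => dependsOn_induced_event ends (U \ {z}) (jProp ends s t v A (W.erase z ∪ T)))
    (fun _ => jEv_reveal_W hzU hzs hzt hzv hzA hzW)

/-- Tower identity for `m`, `z` a `u`-vertex. -/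
lemma prob_mEv_reveal_A {A W : Finset V} (hzA : z ∈ A) (hzW : z ∉ W) :
    prob p (mEv ends U s t v A W) = ∑ ω, weight p ω *
      prob p (mEv ends (U \ {z}) s t v (A.erase z ∪ frontier ends U {z} ω) W) :=
  prob_reveal p ends U z (Φ := fun T => mEv ends (U \ {z}) s t v (A.erase z ∪ T) W)
    (fun T => dependsOn_induced_event ends (U \ {z}) (mProp ends s t v (A.erase z ∪ T) W))
    (fun _ => mEv_reveal_A hzU hzs hzt hzv hzA hzW)

/-- Tower identity for `m`, `z` a `w`-vertex. -/
lemma prob_mEv_reveal_W {A W : Finset V} (hzA : z ∉ A) (hzW : z ∈ W) :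
    prob p (mEv ends U s t v A W) = ∑ ω, weight p ω *
      prob p (mEv ends (U \ {z}) s t v A (W.erase z ∪ frontier ends U {z} ω)) :=
  prob_reveal p ends U z (Φ := fun T => mEv ends (U \ {z}) s t v A (W.erase z ∪ T))
    (fun T => dependsOn_induced_event ends (U \ {z}) (mProp ends s t v A (W.erase z ∪ T)))
    (fun _ => mEv_reveal_W hzU hzs hzt hzv hzA hzW)

end Tower

/-! ## Pinning the edges outside `U`: probabilities on `G[U]` as whole-graph probabilities -/

section Pin

variable {V : Type*} {E : Type*} [Fintype E] [DecidableEq E] {R : Type*} [CommRing R]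

open Classical in
/-- The edge weights of `G[U]`: `p` inside `U`, `0` elsewhere. -/
noncomputable def pinU (p : E → R) (ends : E → Sym2 V) (U : Finset V) : E → R :=
  fun e => if e ∈ within ends (↑U) then p e else 0

omit [Fintype E] [DecidableEq E] in
/-- The pinned weights are admissible. -/
lemma isProbVec_pinU [LinearOrder R] [IsStrictOrderedRing R] {p : E → R} (hp : IsProbVec p)
    (ends : E → Sym2 V) (U : Finset V) : IsProbVec (pinU p ends U) := by
  refine ⟨fun e => ?_, fun e => ?_⟩
  · unfold pinU
    split_ifs
    · exact hp.nonneg e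
    · exact le_rfl
  · unfold pinU
    split_ifs
    · exact hp.le_one e
    · exact zero_le_one

omit [Fintype E] [DecidableEq E] in
/-- The weight of a configuration under the zero weights: `1` on the all-closed configuration,
`0` elsewhere. -/
lemma weight_zero_eq {ι : Type*} [Fintype ι] [DecidableEq ι] (σ : ι → Bool) :
    weight (fun _ : ι => (0 : R)) σ = if σ = (fun _ => false) then 1 else 0 := by
  unfold weight
  split_ifs with h
  · exact Finset.prod_eq_one fun i _ => by rw [h]; simp [edgeFactor]
  · obtain ⟨i, hi⟩ := Function.ne_iff.1 h
    refine Finset.prod_eq_zero (Finset.mem_univ i) ?_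
    have : σ i = true := by revert hi; cases σ i <;> simp
    rw [this]
    simp [edgeFactor]

/-- **Transfer**: the probability under `p` that the configuration induced on `U` lies in `A`
is the probability of `A` under the pinned weights `pinU p ends U`. -/
theorem prob_induced_eq_prob_pinU (p : E → R) (ends : E → Sym2 V) (U : Finset V)
    (A : Set (Config E)) :
    prob p {ω | induced ends (↑U) ω ∈ A} = prob (pinU p ends U) A := by
  classical
  rw [prob_eq_expect_indicator, prob_eq_expect_indicator,
    expect_eq_sum_glue p _ (within ends (↑U)), expect_eq_sum_glue _ _ (within ends (↑U))]
  refine Finset.sum_congr rfl fun σ₁ _ => ?_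
  have hind : ∀ σ₂ : {e // e ∉ within ends (↑U)} → Bool,
      induced ends (↑U) (glue (within ends (↑U)) σ₁ σ₂) =
        glue (within ends (↑U)) σ₁ (fun _ => false) := by
    intro σ₂
    funext e
    unfold induced
    by_cases he : e ∈ within ends (↑U)
    · rw [restrict_apply_of_mem he, glue_apply_of_mem _ _ _ he, glue_apply_of_mem _ _ _ he]
    · rw [restrict_apply_of_notMem he, glue_apply_of_notMem _ _ _ he]
  have hF : (fun i : {e // e ∈ within ends (↑U)} => pinU p ends U i) =
      fun i : {e // e ∈ within ends (↑U)} => p (i : E) := by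
    funext i
    simp [pinU, i.2]
  have hFc : (fun i : {e // e ∉ within ends (↑U)} => pinU p ends U i) =
      fun _ : {e // e ∉ within ends (↑U)} => (0 : R) := by
    funext i
    simp [pinU, i.2]
  have hmem : ∀ ω : Config E, ({ω | induced ends (↑U) ω ∈ A} : Set (Config E)).indicator
      (1 : Config E → R) ω = A.indicator 1 (induced ends (↑U) ω) := by
    intro ω
    by_cases h : induced ends (↑U) ω ∈ A
    · rw [Set.indicator_of_mem (show ω ∈ {ω | induced ends (↑U) ω ∈ A} from h),
        Set.indicator_of_mem h]
      rfl
    · rw [Set.indicator_of_notMem (show ω ∉ {ω | induced ends (↑U) ω ∈ A} from h),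
        Set.indicator_of_notMem h]
  simp_rw [hmem, hind, hF, hFc, weight_zero_eq]
  -- left: the sum over `σ₂` of the outside weights is `1`
  have hL : ∑ σ₂ : {e // e ∉ within ends (↑U)} → Bool,
      weight (fun i : {e // e ∈ within ends (↑U)} => p (i : E)) σ₁ *
        weight (fun i : {e // e ∉ within ends (↑U)} => p (i : E)) σ₂ *
          A.indicator 1 (glue (within ends (↑U)) σ₁ (fun _ => false)) =
      weight (fun i : {e // e ∈ within ends (↑U)} => p (i : E)) σ₁ *
        A.indicator 1 (glue (within ends (↑U)) σ₁ (fun _ => false)) := by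
    calc ∑ σ₂ : {e // e ∉ within ends (↑U)} → Bool,
          weight (fun i : {e // e ∈ within ends (↑U)} => p (i : E)) σ₁ *
            weight (fun i : {e // e ∉ within ends (↑U)} => p (i : E)) σ₂ *
              A.indicator 1 (glue (within ends (↑U)) σ₁ (fun _ => false))
        = (∑ σ₂ : {e // e ∉ within ends (↑U)} → Bool,
            weight (fun i : {e // e ∉ within ends (↑U)} => p (i : E)) σ₂) *
            (weight (fun i : {e // e ∈ within ends (↑U)} => p (i : E)) σ₁ *
              A.indicator 1 (glue (within ends (↑U)) σ₁ (fun _ => false))) := by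
          rw [Finset.sum_mul]
          exact Finset.sum_congr rfl fun σ₂ _ => by ring
      _ = _ := by rw [sum_weight, one_mul]
  -- right: only the all-closed outside configuration contributes
  have hR : ∑ σ₂ : {e // e ∉ within ends (↑U)} → Bool,
      weight (fun i : {e // e ∈ within ends (↑U)} => p (i : E)) σ₁ *
        (if σ₂ = (fun _ => false) then (1 : R) else 0) *
          A.indicator 1 (glue (within ends (↑U)) σ₁ σ₂) =
      weight (fun i : {e // e ∈ within ends (↑U)} => p (i : E)) σ₁ *
        A.indicator 1 (glue (within ends (↑U)) σ₁ (fun _ => false)) := by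
    rw [Finset.sum_eq_single (fun _ => false)]
    · simp
    · intro σ₂ _ hne
      rw [if_neg hne]
      ring
    · intro h
      exact absurd (Finset.mem_univ _) h
  rw [hL, hR]

end Pin

end BTVFamily

end Summit.Ventures.PercRepro2
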